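import Mathlib
import HarnessLib
import Summits.HubbardSuperconductivity.HubbardSuperconductivity.Theorems.KLProgrammeC4aCausticWindowDispatch
import Summits.HubbardSuperconductivity.HubbardSuperconductivity.Theorems.KLProgrammeC4aPreCausticAngleLayer

/-!
# Route `KLProgramme` — crux C4a, S3 brick (B4) «(B4)-UMK1», «(M2)-DISPATCH» glue: the output of the pre-caustic angle layer (N2) in the shape the dispatcher's
# pre-side hypothesis asks — the logarithm `log((√c·L + √δ₀)/√δ₀)` of `…C4aPreCausticAngleLayer` is `≤ log 2 + ½·log(Γ/δ₀)`, so the (N2) value is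
# `A·lo·(m₀⁻¹(√m₀)⁻¹) + B + B′·log(Γ/δ₀)` with explicit `A, B, B′`

Cell `gate-hubbard-kl`, seat hubbard-kl-k3c3-p3 (g29; row «implicit-function / monotonicity route for μ(n)»).  Located brick for the (C)-closer lane hubbard-kl-c4a-1
(stub (C) `stub_twoLeg_curvature` of `KLRegimeEngineV17F2`, stmt-HubbardSuperconductivity-20437), memo HOME/hubbard-kl-k3c3-p3/U1-CAUSTIC-SUP.md §7–§8 (M4) glue.
`…C4aPreCausticAngleLayer.intervalIntegral_pre_caustic_angle_le` bounds the pre-caustic loop-angle integral at tube angle `ϑ` (offset `δ₀ = δ₀(ϑ) > 0`) by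
`2A₁·16lo/(3√c·m₀√m₀) + 2A₂·(4/c)·log((√c(β−α) + √δ₀)/√δ₀) + A₃(β−α)`, `m₀ = max δ₀ lo`; `…C4aCausticWindowDispatch.intervalIntegral_caustic_dispatch_log_le` asks, where
`m ϑ > 0`, `F ϑ ≤ A·(lo·((max |m ϑ| lo)⁻¹·(√(max |m ϑ| lo))⁻¹)) + B + B′·log(Γ/|m ϑ|)`.  This file is the adapter:
* `log_add_sqrt_div_sqrt_le`: `0 < x ≤ Γ`, `0 ≤ a`, `a² ≤ Γ` ⟹ `log((a + √x)/√x) ≤ log 2 + ½·log(Γ/x)` (two cases `a ≤ √x` / `√x < a`);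
* **`pre_caustic_angle_value_le_dispatch_shape`**: with `Γ ≥ max(c(β−α)², δ₀)` the (N2) value is
  `≤ (32A₁/(3√c))·(lo·(m₀⁻¹(√m₀)⁻¹)) + (A₃(β−α) + (8A₂/c)·log 2) + (4A₂/c)·log(Γ/δ₀)` — i.e. `A = 32A₁/(3√c)`, `B = A₃(β−α) + (8A₂/c)log 2`, `B′ = 4A₂/c`,
  and `|δ₀| = δ₀`, so the dispatcher's `hpre` is met verbatim at every `ϑ` with `δ₀(ϑ) > 0`.
Pure real analysis; nothing about the model; nothing asserts (C), K3 or superconductivity.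
References: Salmhofer 1999 §4.5.3 [cite: Salmhofer1999]; FST II CPAM 51 (1998) §3 [cite: FeldmanSalmhoferTrubowitz1998].
-/

noncomputable section

namespace Summit.HubbardSuperconductivity.HubbardSuperconductivity.Theorems.C4a

set_option linter.dupNamespace false -- summit = problem name (single-conjunct summit), D-0017

open Real Set

/-- **The angle-layer logarithm against `log(Γ/x)`**: `0 < x ≤ Γ`, `0 ≤ a`, `a² ≤ Γ` ⟹ `log((a + √x)/√x) ≤ log 2 + ½·log(Γ/x)`. -/
theorem log_add_sqrt_div_sqrt_le {a x Γ : ℝ} (hx : 0 < x) (hxΓ : x ≤ Γ) (ha : 0 ≤ a) (haΓ : a ^ 2 ≤ Γ) :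
    Real.log ((a + Real.sqrt x) / Real.sqrt x) ≤ Real.log 2 + 1 / 2 * Real.log (Γ / x) := by
  have hsx : 0 < Real.sqrt x := Real.sqrt_pos.2 hx
  have hΓ : 0 < Γ := lt_of_lt_of_le hx hxΓ
  have hΓx : 1 ≤ Γ / x := by rw [le_div_iff₀ hx, one_mul]; exact hxΓ
  have hlogΓ : 0 ≤ Real.log (Γ / x) := Real.log_nonneg hΓx
  have hlog2 : 0 ≤ Real.log 2 := Real.log_nonneg (by norm_num)
  have hq : 0 < (a + Real.sqrt x) / Real.sqrt x := by positivity
  rcases le_or_gt a (Real.sqrt x) with hle | hgt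
  · -- `(a + √x)/√x ≤ 2`
    have h1 : (a + Real.sqrt x) / Real.sqrt x ≤ 2 := by
      rw [div_le_iff₀ hsx]; linarith
    have h2 : Real.log ((a + Real.sqrt x) / Real.sqrt x) ≤ Real.log 2 := Real.log_le_log hq h1
    linarith
  · -- `(a + √x)/√x ≤ 2a/√x` and `log(a/√x) = ½ log(a²/x) ≤ ½ log(Γ/x)`
    have ha0 : 0 < a := lt_of_le_of_lt hsx.le hgt
    have h1 : (a + Real.sqrt x) / Real.sqrt x ≤ 2 * (a / Real.sqrt x) := by
      rw [mul_div_assoc', div_le_div_iff_of_pos_right hsx]; linarith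
    have h2 : Real.log ((a + Real.sqrt x) / Real.sqrt x) ≤ Real.log 2 + Real.log (a / Real.sqrt x) := by
      have h := Real.log_le_log hq h1
      rwa [Real.log_mul (by norm_num) (div_pos ha0 hsx).ne'] at h
    have h3 : Real.log (a / Real.sqrt x) = 1 / 2 * Real.log (a ^ 2 / x) := by
      have e1 : a / Real.sqrt x = Real.sqrt (a ^ 2 / x) := by
        rw [Real.sqrt_div (sq_nonneg a), Real.sqrt_sq ha]
      rw [e1, Real.log_sqrt (div_nonneg (sq_nonneg a) hx.le)]
      ring
    have h4 : Real.log (a ^ 2 / x) ≤ Real.log (Γ / x) :=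
      Real.log_le_log (div_pos (pow_pos ha0 2) hx) (div_le_div_of_nonneg_right haΓ hx.le)
    rw [h3] at h2
    linarith

/-- **THE (N2) VALUE IN DISPATCH SHAPE.**  `0 < c`, `0 < δ₀`, `0 < lo`, `A₂ ≥ 0`, `α ≤ β`, and a ceiling `Γ` with `c(β − α)² ≤ Γ`, `δ₀ ≤ Γ`.  THEN the value of
`…C4aPreCausticAngleLayer.intervalIntegral_pre_caustic_angle_le` is at most
`(32A₁/(3√c))·(lo·((max |δ₀| lo)⁻¹·(√(max |δ₀| lo))⁻¹)) + (A₃(β − α) + (8A₂/c)·log 2) + (4A₂/c)·log(Γ/|δ₀|)` — the `hpre` of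
`…C4aCausticWindowDispatch.intervalIntegral_caustic_dispatch_log_le` with `A = 32A₁/(3√c)`, `B = A₃(β−α) + (8A₂/c)log 2`, `B′ = 4A₂/c`. -/
theorem pre_caustic_angle_value_le_dispatch_shape {c δ₀ lo A₁ A₂ A₃ α β Γ : ℝ} (hc : 0 < c) (hδ₀ : 0 < δ₀) (hlo : 0 < lo)
    (hA₂ : 0 ≤ A₂) (hαβ : α ≤ β) (hΓ₁ : c * (β - α) ^ 2 ≤ Γ) (hΓ₂ : δ₀ ≤ Γ) :
    2 * (A₁ * (16 * lo / (3 * Real.sqrt c * (max δ₀ lo * Real.sqrt (max δ₀ lo))))) +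
        2 * (A₂ * (4 / c * Real.log ((Real.sqrt c * (β - α) + Real.sqrt δ₀) / Real.sqrt δ₀))) + A₃ * (β - α) ≤
      32 * A₁ / (3 * Real.sqrt c) * (lo * ((max |δ₀| lo)⁻¹ * (Real.sqrt (max |δ₀| lo))⁻¹)) +
        (A₃ * (β - α) + 8 * A₂ / c * Real.log 2) + 4 * A₂ / c * Real.log (Γ / |δ₀|) := by
  have hsc : 0 < Real.sqrt c := Real.sqrt_pos.2 hc
  rw [abs_of_pos hδ₀]
  set m₀ := max δ₀ lo with hm₀
  have hm₀pos : 0 < m₀ := lt_max_of_lt_right hlo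
  have hsm : 0 < Real.sqrt m₀ := Real.sqrt_pos.2 hm₀pos
  -- the first term is an identity
  have h1 : 2 * (A₁ * (16 * lo / (3 * Real.sqrt c * (m₀ * Real.sqrt m₀)))) = 32 * A₁ / (3 * Real.sqrt c) * (lo * (m₀⁻¹ * (Real.sqrt m₀)⁻¹)) := by
    field_simp
    ring
  -- the logarithm
  have ha : 0 ≤ Real.sqrt c * (β - α) := mul_nonneg hsc.le (sub_nonneg.2 hαβ)
  have haΓ : (Real.sqrt c * (β - α)) ^ 2 ≤ Γ := by
    rw [mul_pow, Real.sq_sqrt hc.le]; exact hΓ₁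
  have hlog := log_add_sqrt_div_sqrt_le hδ₀ hΓ₂ ha haΓ
  have h2 : 2 * (A₂ * (4 / c * Real.log ((Real.sqrt c * (β - α) + Real.sqrt δ₀) / Real.sqrt δ₀))) ≤
      8 * A₂ / c * Real.log 2 + 4 * A₂ / c * Real.log (Γ / δ₀) := by
    have hcoef : 0 ≤ 8 * A₂ / c := by positivity
    have h := mul_le_mul_of_nonneg_left hlog hcoef
    have e1 : 2 * (A₂ * (4 / c * Real.log ((Real.sqrt c * (β - α) + Real.sqrt δ₀) / Real.sqrt δ₀))) =
        8 * A₂ / c * Real.log ((Real.sqrt c * (β - α) + Real.sqrt δ₀) / Real.sqrt δ₀) := by ring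
    have e2 : 8 * A₂ / c * (Real.log 2 + 1 / 2 * Real.log (Γ / δ₀)) = 8 * A₂ / c * Real.log 2 + 4 * A₂ / c * Real.log (Γ / δ₀) := by ring
    rw [e1]; rw [e2] at h; exact h
  rw [h1]
  linarith

end Summit.HubbardSuperconductivity.HubbardSuperconductivity.Theorems.C4a

end
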